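import Summits.NavierStokesRegularity.NavierStokesRegularity.Theorems.HeredityAtOne.Negative.NoSwirlSliceStratum
import Summits.NavierStokesRegularity.NavierStokesRegularity.Theorems.HeredityAtOne.Negative.CapStratum
import Summits.NavierStokesRegularity.FluidComputer.PalasekTowerRegisterGlobalFirstHitting
import Literature.Analysis.FluidPDE.AxisymNoSwirlQuotMaxPrinciple
import Literature.Analysis.FluidPDE.AxisymNoSwirlWeightedCoSignedFlux
import Literature.Analysis.FluidPDE.AxisymNoSwirlImpulseConservation
import Literature.Analysis.FluidPDE.AxisymmetricNoSwirlGlobal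

/-!
# The capped signed swirl-free stratum is FORWARD-INVARIANT under silent evolution: the LEVEL-ZERO reading

Cell `ns-blowup`, seat `refuter-ns-palasek-19249-disprove-1` (g4; DISPROVER, route `PalasekTowerBreakdown`, item
stmt-NavierStokesRegularity-19249 `HeredityAtOne`). NEGATIVE-LANE lemmas (no positive Theses conclusion), sorry-free,
def-free, NO named fact: the cap enters through the tree theorem `isNoSwirlCapConstant_eighth` (`C = 0.35356`), the
class propagation through the tree theorems `IsTaoSolutionOn.isAxisymmetric / hasNoSwirl`, the `ω_θ/r` maximum
principle (`…angVortQuot_nonneg_of_datum / abs_angVortQuot_le_of_datum`), GS15 Lemma 5.1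
(`…integrable_angVortQuot_of_datum`) and GS15 Lemma 6.4 (`GallaySverak2015.ImpulseConservation_holds`).

§1 **The cap value is non-increasing along unforced runs.** A finite-energy classical UNFORCED run on `[a, b]` from
an `H^∞` single-signed swirl-free slice of height `M` stays in that class (`signedNoSwirlSlice_of_sobolevDatum`),
with `∫η(t) ≤ ∫η(t₀)` and `∫r²η(t) = ∫r²η(t₀)`; so `C √(√((∫η)(∫r²η)) M)` does not increase (`cap_le_cap_of_sobolevDatum`).

§2 **SILENT designs** (`S.f t = 0` for `t ≥ τ₀`; a sub-register of the quiet ones, `quiet_of_silent`): for a stage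
`s` at level `k` whose `τ₀`-slice — the HOST readout, shaped by the free pre-anchor force — is single-signed
swirl-free of height `M` with cap value `Φ₀ = C √(√((∫η₀)(∫r²η₀)) M)`:
  (i) every registered slice `s.u t`, `t ∈ [τ₀, τ_k]`, is in the class with cap value `≤ Φ₀`
      (`signedNoSwirlSlice_of_silent`, `cap_le_cap_τ_zero_of_silent`); `0.35356·cap₀ < c₁ Y_{k+1}` puts `s` IN the
      census stratum `InCapStratum k S s` (`inCapStratum_of_silent`): the level-zero class is NESTED, not a new door;
 (ii) speed `≤ Φ₀` on `[τ₀, τ_k] × ℝ³` (`speed_le_cap_τ_zero_of_silent`, `k ≥ 1`), hence `c₁ Y_j ≤ Φ₀` for all `j ≤ k`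
      (`floor_le_cap_τ_zero_of_silent`): NO silent design with `Φ₀ < c₁ Y_k` registers level `k`;
(iii) with the global anchor (`‖u(τ₀, ·)‖ ≤ c₁ Y₀`, `Stage.norm_τ_zero_le`) the host is at most `Y₀/Y₁ ≤ 1/2`
      cap-efficient (`two_mul_norm_τ_zero_le_cap_of_silent`). NUMBERS (rigid wide register, `c₁ = 1`): a silent
      design registering level `1` from such a host needs `Y₁ = 2778 ≤ 0.35356·cap₀` (`cap₀ ≥ 7857`) while
      `sup|u(τ₀)| = Y₀ = 1351`: host efficiency `sup|u(τ₀)|/cap₀ ≤ 0.35356·Y₀/Y₁ = 0.1720` — Hill's spherical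
      vortex (`0.2048`) and fat tori (`s/R = 0.9`: `0.206`) are EXCLUDED as hosts, thin uniform-core rings
      (`1/(2√2π) = 0.1125`) are not (ratios: kit j264797, `RestDesign.lean`); in host units (`sup|u(τ₀)| = ν = 1`)
      the free signed swirl-free flow must then DOUBLE its sup-speed (`×Y₁/Y₀ = 2.056`) by time
      `w₀ Y₀² = 61.73·Y₀/N₀ ≈ 326` from a host of core Reynolds number `Y₀/N₀ ≈ 5.3` — `EpisodeBaseG` on the
      sub-register, open;
 (iv) THE LEVER AT EVERY LEVEL `k ≥ 0` (`not_heredityAt_of_silent_capped_τ_zero`): ONE level-`k` stage of a pinned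
      rigid silent wide design with such a host and `Φ₀ < c₁ Y_{k+1}` refutes `HeredityAt k`; at `k = 1` on the route
      decl (`heredityAtOne_false_of_silent_capped_τ_zero`, window `cap₀ ∈ [7857, 17366)`); at `k = 0` no window.

WHAT THIS IS NOT: not Navier–Stokes evidence, no verdict change — no stage, design or slice is constructed; the
class is uninhabited in the tree. Learning for the proof side: on silent designs item 19249's emptiness conjunct
(`CapStratumEmptyAt 1` of `heredityAtOne_iff_offStratum_and_empty`) is decided by the DESIGNABLE host slice alone.
References: Gallay–Šverák, arXiv:1510.01036 [cite: GallaySverak2016, Prop. 2.6 (p. 8), Lemma 5.1 (p. 16), Lemma 6.4 (p. 19)];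
Koch–Nadirashvili–Seregin–Šverák, Acta Math. 203 (2009) [cite: KochNadirashviliSereginSverak2009, §5];
Tao, Anal. PDE 6 (2013) [cite: Tao2011, Cor. 11.1]; Palasek, arXiv:2605.13827 [cite: Palasek2026ElementaryModel, §4].
-/
noncomputable section

namespace Summit.NavierStokesRegularity.HeredityAtOneSilentWindow

open Set MeasureTheory Filter Topology Function
open scoped ENNReal NNReal ContDiff
open Literature.Analysis.FluidPDE
open Summit.NavierStokesRegularity.FluidComputer
open Summit.NavierStokesRegularity.FluidComputer.PalasekTowerClayBridge
open Summit.NavierStokesRegularity.NavierStokesRegularity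
open Summit.NavierStokesRegularity.HeredityAtOneNoSwirlCap
open Summit.NavierStokesRegularity.HeredityAtOneSpeedCap
open Summit.NavierStokesRegularity.HeredityAtOneNoSwirlStratum

/-! ## §1 Monotonicity of the cap value along finite-energy classical unforced runs -/

section Run

variable {T₀ : Set ℝ} {v : ℝ → EuclideanSpace ℝ (Fin 3) → EuclideanSpace ℝ (Fin 3)} {t₀ : ℝ} {M : ℝ}

/-- **Restart in Tao's class**: a finite-energy classical solution `(u, p)` on `[a, b]` of a system whose force
vanishes on the slab, starting from an `H^∞` slice `v t₀` (`v` with bounded Sobolev norms of all orders on a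
time set `T₀ ∋ t₀`), is — translated to start at time `0` — a Tao-class solution on `[0, b − a]` from `v t₀`
(Tao 2013 Cor. 11.1 for an `H^∞` datum; no spatial decay of the slice is needed). [cite: Tao2011, Cor. 11.1] -/
theorem exists_isTaoSolutionOn_of_sobolevDatum (hv : HasBoundedSobolevNormsOn T₀ v) (ht₀ : t₀ ∈ T₀)
    ⦃a b : ℝ⦄ (hab : a < b) (f u : ℝ → EuclideanSpace ℝ (Fin 3) → EuclideanSpace ℝ (Fin 3))
    (p : ℝ → EuclideanSpace ℝ (Fin 3) → ℝ) (hu : IsClassicalNSSolutionOn (Icc a b) 1 f u p)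
    (hf : ∀ t ∈ Icc a b, f t = 0)
    (hE : ∃ C : ℝ≥0∞, C < ⊤ ∧ ∀ t ∈ Icc a b, ∫⁻ x, ‖u t x‖ₑ ^ 2 ≤ C) (hua : u a = v t₀) :
    ∃ q : ℝ → EuclideanSpace ℝ (Fin 3) → ℝ, IsTaoSolutionOn (b - a) 1 (v t₀) (fun σ => u (σ + a)) q := by
  have hT : 0 < b - a := sub_pos.2 hab
  have hpre : Icc 0 (b - a) ⊆ (fun σ => σ + a) ⁻¹' Icc a b := by
    intro σ hσ
    simp only [mem_preimage, mem_Icc] at hσ ⊢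
    constructor <;> linarith [hσ.1, hσ.2]
  have hcl : IsClassicalNSSolutionOn (Icc 0 (b - a)) 1 0 (fun σ => u (σ + a))
      (fun σ => p (σ + a)) :=
    ((hu.comp_add_right a).mono hpre (uniqueDiffOn_Icc hT)).congr_force fun σ hσ x => by
      have hft : f (σ + a) = 0 := hf _ (hpre hσ)
      simp only [hft, Pi.zero_apply]
  have hE' : ∃ C : ℝ≥0, ∀ σ ∈ Icc 0 (b - a), ∫⁻ x, ‖u (σ + a) x‖ₑ ^ 2 ≤ C := by
    obtain ⟨C, hC, hb⟩ := hE
    exact ⟨C.toNNReal, fun σ hσ => (hb _ (hpre hσ)).trans (ENNReal.coe_toNNReal hC.ne).ge⟩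
  have hu0 : (fun σ => u (σ + a)) 0 = v t₀ := by simp only [zero_add]; exact hua
  have hSob : HasBoundedSobolevNormsOn (Icc 0 (b - a)) (fun σ => u (σ + a)) :=
    (hcl.exists_norm_le_of_restart_unforced hv ht₀ one_pos hT hE' hu0).1
  have hHk : IsHkClassicalSolutionOn (Icc 0 (b - a)) (fun σ => u (σ + a)) (fun σ => p (σ + a)) :=
    ⟨hcl, fun n => by
      obtain ⟨Cn, hCn⟩ := hSob n
      exact ⟨max 1 Cn, fun σ hσ => eLpNorm_two_le_max_of_lintegral_sq_le (hCn σ hσ)⟩⟩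
  obtain ⟨q, hTao⟩ := hHk.exists_isTaoSolutionOn hT
  exact ⟨q, by simpa only [zero_add, hua] using hTao⟩

/-- **The single-signed swirl-free class PROPAGATES along finite-energy classical unforced runs** (setting of
`exists_isTaoSolutionOn_of_sobolevDatum`; axisymmetry / no swirl propagate in Tao's class, `0 ≤ ω_θ/r ≤ M` by the
maximum principle, `L¹` by GS15 Lemma 5.1, impulse by GS15 Lemma 6.4). [cite: GallaySverak2016, Lemma 5.1, Lemma 6.4]
[cite: KochNadirashviliSereginSverak2009, §5] -/
theorem signedNoSwirlSlice_of_sobolevDatum (hv : HasBoundedSobolevNormsOn T₀ v) (ht₀ : t₀ ∈ T₀)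
    (hsl : SignedNoSwirlSlice (v t₀) M) ⦃a b : ℝ⦄ (hab : a < b)
    (f u : ℝ → EuclideanSpace ℝ (Fin 3) → EuclideanSpace ℝ (Fin 3))
    (p : ℝ → EuclideanSpace ℝ (Fin 3) → ℝ) (hu : IsClassicalNSSolutionOn (Icc a b) 1 f u p)
    (hf : ∀ t ∈ Icc a b, f t = 0)
    (hE : ∃ C : ℝ≥0∞, C < ⊤ ∧ ∀ t ∈ Icc a b, ∫⁻ x, ‖u t x‖ₑ ^ 2 ≤ C) (hua : u a = v t₀) :
    ∀ t ∈ Icc a b, SignedNoSwirlSlice (u t) M := by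
  have hT : 0 < b - a := sub_pos.2 hab
  obtain ⟨q, hTao⟩ := exists_isTaoSolutionOn_of_sobolevDatum hv ht₀ hab f u p hu hf hE hua
  intro t ht
  have hσ : t - a ∈ Icc 0 (b - a) := ⟨by linarith [ht.1], by linarith [ht.2]⟩
  have hM : ∀ x, |angVortQuot (v t₀) x| ≤ M := fun x => by
    rw [abs_of_nonneg (hsl.nonneg x)]
    exact hsl.le x
  have hax := hTao.isAxisymmetric one_pos hT hsl.axisym (t - a) hσ
  have hsw := hTao.hasNoSwirl one_pos hT hsl.axisym hsl.noSwirl (t - a) hσ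
  have hnn := fun x =>
    hTao.angVortQuot_nonneg_of_datum hT one_pos hsl.axisym hsl.noSwirl hsl.nonneg hσ x
  have hle := fun x => hTao.abs_angVortQuot_le_of_datum hT one_pos hsl.axisym hsl.noSwirl hM hσ x
  have hint :=
    (hTao.integrable_angVortQuot_of_datum hT one_pos hsl.axisym hsl.noSwirl hsl.integrable hσ).1
  have himp := (GallaySverak2015.ImpulseConservation_holds hT hTao hsl.axisym hsl.noSwirl hsl.nonneg
    hsl.integrable hsl.integrable_sq (t - a) hσ).1
  simp only [sub_add_cancel] at hax hsw hnn hle hint himp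
  exact ⟨hax, hsw, hnn, fun x => (abs_le.1 (hle x)).2, hint, himp⟩

/-- **GS15 Lemma 5.1 along the run**: `∫ (ω_θ/r)(u t) ≤ ∫ (ω_θ/r)(v t₀)` for `t ∈ [a, b]` (both slices are
nonnegative and integrable). [cite: GallaySverak2016, Lemma 5.1] -/
theorem integral_angVortQuot_le_of_sobolevDatum (hv : HasBoundedSobolevNormsOn T₀ v) (ht₀ : t₀ ∈ T₀)
    (hsl : SignedNoSwirlSlice (v t₀) M) ⦃a b : ℝ⦄ (hab : a < b)
    (f u : ℝ → EuclideanSpace ℝ (Fin 3) → EuclideanSpace ℝ (Fin 3))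
    (p : ℝ → EuclideanSpace ℝ (Fin 3) → ℝ) (hu : IsClassicalNSSolutionOn (Icc a b) 1 f u p)
    (hf : ∀ t ∈ Icc a b, f t = 0)
    (hE : ∃ C : ℝ≥0∞, C < ⊤ ∧ ∀ t ∈ Icc a b, ∫⁻ x, ‖u t x‖ₑ ^ 2 ≤ C) (hua : u a = v t₀) :
    ∀ t ∈ Icc a b, ∫ y, angVortQuot (u t) y ≤ ∫ y, angVortQuot (v t₀) y := by
  have hT : 0 < b - a := sub_pos.2 hab
  obtain ⟨q, hTao⟩ := exists_isTaoSolutionOn_of_sobolevDatum hv ht₀ hab f u p hu hf hE hua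
  intro t ht
  have hσ : t - a ∈ Icc 0 (b - a) := ⟨by linarith [ht.1], by linarith [ht.2]⟩
  have h := hTao.integrable_angVortQuot_of_datum hT one_pos hsl.axisym hsl.noSwirl hsl.integrable hσ
  simp only [sub_add_cancel] at h
  obtain ⟨hint, h2⟩ := h
  have hnn : ∀ x, 0 ≤ angVortQuot (u t) x :=
    (signedNoSwirlSlice_of_sobolevDatum hv ht₀ hsl hab f u p hu hf hE hua t ht).nonneg
  have h0 : 0 ≤ ∫ y, angVortQuot (v t₀) y := integral_nonneg hsl.nonneg
  rw [← ENNReal.ofReal_le_ofReal_iff h0,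
    ofReal_integral_eq_lintegral_ofReal hint (Eventually.of_forall hnn),
    ofReal_integral_eq_lintegral_ofReal hsl.integrable (Eventually.of_forall hsl.nonneg)]
  calc ∫⁻ x, ENNReal.ofReal (angVortQuot (u t) x)
      = ∫⁻ x, ‖angVortQuot (u t) x‖ₑ := lintegral_congr fun x => (Real.enorm_eq_ofReal (hnn x)).symm
    _ ≤ ∫⁻ x, ‖angVortQuot (v t₀) x‖ₑ := h2
    _ = ∫⁻ x, ENNReal.ofReal (angVortQuot (v t₀) x) :=
        lintegral_congr fun x => Real.enorm_eq_ofReal (hsl.nonneg x)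

/-- **GS15 Lemma 6.4 along the run (conservation of the impulse)**: `∫ r²(ω_θ/r)(u t) = ∫ r²(ω_θ/r)(v t₀)` for
`t ∈ [a, b]`. [cite: GallaySverak2016, Lemma 6.4] -/
theorem integral_rsq_angVortQuot_eq_of_sobolevDatum (hv : HasBoundedSobolevNormsOn T₀ v) (ht₀ : t₀ ∈ T₀)
    (hsl : SignedNoSwirlSlice (v t₀) M) ⦃a b : ℝ⦄ (hab : a < b)
    (f u : ℝ → EuclideanSpace ℝ (Fin 3) → EuclideanSpace ℝ (Fin 3))
    (p : ℝ → EuclideanSpace ℝ (Fin 3) → ℝ) (hu : IsClassicalNSSolutionOn (Icc a b) 1 f u p)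
    (hf : ∀ t ∈ Icc a b, f t = 0)
    (hE : ∃ C : ℝ≥0∞, C < ⊤ ∧ ∀ t ∈ Icc a b, ∫⁻ x, ‖u t x‖ₑ ^ 2 ≤ C) (hua : u a = v t₀) :
    ∀ t ∈ Icc a b, ∫ y, cylRadius y ^ 2 * angVortQuot (u t) y =
      ∫ y, cylRadius y ^ 2 * angVortQuot (v t₀) y := by
  have hT : 0 < b - a := sub_pos.2 hab
  obtain ⟨q, hTao⟩ := exists_isTaoSolutionOn_of_sobolevDatum hv ht₀ hab f u p hu hf hE hua
  intro t ht
  have hσ : t - a ∈ Icc 0 (b - a) := ⟨by linarith [ht.1], by linarith [ht.2]⟩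
  have h := (GallaySverak2015.ImpulseConservation_holds hT hTao hsl.axisym hsl.noSwirl hsl.nonneg
    hsl.integrable hsl.integrable_sq (t - a) hσ).2
  simpa only [sub_add_cancel] using h

/-- **The cap value is NON-INCREASING along finite-energy classical unforced runs** from a single-signed
swirl-free `H^∞` slice: `C √(√((∫η(t))(∫r²η(t))) M) ≤ C √(√((∫η(t₀))(∫r²η(t₀))) M)` for `t ∈ [a, b]` and every
`C ≥ 0` (`∫η` non-increasing, `∫r²η` conserved, `M ≥ 0`). [cite: GallaySverak2016, Prop. 2.6, Lemma 5.1, Lemma 6.4] -/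
theorem cap_le_cap_of_sobolevDatum {C : ℝ} (hC : 0 ≤ C) (hv : HasBoundedSobolevNormsOn T₀ v)
    (ht₀ : t₀ ∈ T₀) (hsl : SignedNoSwirlSlice (v t₀) M) ⦃a b : ℝ⦄ (hab : a < b)
    (f u : ℝ → EuclideanSpace ℝ (Fin 3) → EuclideanSpace ℝ (Fin 3))
    (p : ℝ → EuclideanSpace ℝ (Fin 3) → ℝ) (hu : IsClassicalNSSolutionOn (Icc a b) 1 f u p)
    (hf : ∀ t ∈ Icc a b, f t = 0)
    (hE : ∃ C : ℝ≥0∞, C < ⊤ ∧ ∀ t ∈ Icc a b, ∫⁻ x, ‖u t x‖ₑ ^ 2 ≤ C) (hua : u a = v t₀) :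
    ∀ t ∈ Icc a b,
      C * Real.sqrt (Real.sqrt ((∫ y, angVortQuot (u t) y) *
          ∫ y, cylRadius y ^ 2 * angVortQuot (u t) y) * M) ≤
        C * Real.sqrt (Real.sqrt ((∫ y, angVortQuot (v t₀) y) *
          ∫ y, cylRadius y ^ 2 * angVortQuot (v t₀) y) * M) := by
  intro t ht
  have hI := integral_angVortQuot_le_of_sobolevDatum hv ht₀ hsl hab f u p hu hf hE hua t ht
  have hJ := integral_rsq_angVortQuot_eq_of_sobolevDatum hv ht₀ hsl hab f u p hu hf hE hua t ht
  have hM : 0 ≤ M := (hsl.nonneg 0).trans (hsl.le 0)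
  have hJ0 : 0 ≤ ∫ y, cylRadius y ^ 2 * angVortQuot (v t₀) y :=
    integral_nonneg fun y => mul_nonneg (sq_nonneg _) (hsl.nonneg y)
  rw [hJ]
  exact mul_le_mul_of_nonneg_left (Real.sqrt_le_sqrt (mul_le_mul_of_nonneg_right
    (Real.sqrt_le_sqrt (mul_le_mul_of_nonneg_right hI hJ0)) hM)) hC

end Run

/-! ## §2 The level-zero reading: SILENT designs (the force vanishes from `τ₀` on) -/

section Silent

variable {R : TowerRates} {S : Schedule R} {m : Margins R} {k : ℕ}

/-- A silent design (`S.f t = 0` for `t ≥ τ₀`) is quiet (`S.f t = 0` for `t ≥ τ₁`). [folklore] -/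
theorem quiet_of_silent (hSil : ∀ t, S.τ 0 ≤ t → S.f t = 0) : S.Quiet :=
  fun t ht => hSil t ((S.τ_mono (Nat.zero_le 1)).trans ht)

/-- On a silent design a stage restricted to `[τ₀, τ_k]` is an unforced finite-energy classical run. [folklore] -/
theorem run_from_τ_zero (hSil : ∀ t, S.τ 0 ≤ t → S.f t = 0) (s : Stage 1 R S m k) (h0k : S.τ 0 < S.τ k) :
    IsClassicalNSSolutionOn (Icc (S.τ 0) (S.τ k)) 1 S.f s.u s.p ∧
      (∀ t ∈ Icc (S.τ 0) (S.τ k), S.f t = 0) ∧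
      ∃ C : ℝ≥0∞, C < ⊤ ∧ ∀ t ∈ Icc (S.τ 0) (S.τ k), ∫⁻ x, ‖s.u t x‖ₑ ^ 2 ≤ C := by
  refine ⟨s.classical.mono (Icc_subset_Icc_left (S.τ_pos 0).le) (uniqueDiffOn_Icc h0k),
    fun t ht => hSil t ht.1, ?_⟩
  obtain ⟨C, hC, hb⟩ := s.energy
  exact ⟨C, hC, fun t ht => hb t ⟨(S.τ_pos 0).le.trans ht.1, ht.2⟩⟩

/-- **(i) Forward invariance on the register.** On a silent design, if the `τ₀`-slice of a stage (any rates,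
margins, level) is single-signed swirl-free of height `M`, so is every later slice `s.u t`, `t ∈ [τ₀, τ_k]`.
[cite: GallaySverak2016, Lemma 5.1, Lemma 6.4] [cite: KochNadirashviliSereginSverak2009, §5] -/
theorem signedNoSwirlSlice_of_silent (hSil : ∀ t, S.τ 0 ≤ t → S.f t = 0) (s : Stage 1 R S m k) {M : ℝ}
    (hsl : SignedNoSwirlSlice (s.u (S.τ 0)) M) :
    ∀ t ∈ Icc (S.τ 0) (S.τ k), SignedNoSwirlSlice (s.u t) M := by
  intro t ht
  rcases (S.τ_mono (Nat.zero_le k)).eq_or_lt with h0k | h0k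
  · have htt : t = S.τ 0 := le_antisymm (h0k ▸ ht.2) ht.1
    rw [htt]
    exact hsl
  · obtain ⟨hcl, hf0, hE⟩ := run_from_τ_zero hSil s h0k
    exact signedNoSwirlSlice_of_sobolevDatum (stage_hasBoundedSobolevNormsOn s) s.τ_zero_mem_Icc hsl
      h0k S.f s.u s.p hcl hf0 hE rfl t ht

/-- **(i′) The cap value of the registered slices is under the host's**: on a silent design with single-signed
swirl-free `τ₀`-slice of height `M`, `C·(cap value of s.u t) ≤ C·(cap value of s.u τ₀)` for `t ∈ [τ₀, τ_k]`,
`C ≥ 0`. [cite: GallaySverak2016, Prop. 2.6, Lemma 5.1, Lemma 6.4] -/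
theorem cap_le_cap_τ_zero_of_silent {C : ℝ} (hC : 0 ≤ C) (hSil : ∀ t, S.τ 0 ≤ t → S.f t = 0)
    (s : Stage 1 R S m k) {M : ℝ} (hsl : SignedNoSwirlSlice (s.u (S.τ 0)) M) :
    ∀ t ∈ Icc (S.τ 0) (S.τ k),
      C * Real.sqrt (Real.sqrt ((∫ y, angVortQuot (s.u t) y) *
          ∫ y, cylRadius y ^ 2 * angVortQuot (s.u t) y) * M) ≤
        C * Real.sqrt (Real.sqrt ((∫ y, angVortQuot (s.u (S.τ 0)) y) *
          ∫ y, cylRadius y ^ 2 * angVortQuot (s.u (S.τ 0)) y) * M) := by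
  intro t ht
  rcases (S.τ_mono (Nat.zero_le k)).eq_or_lt with h0k | h0k
  · have htt : t = S.τ 0 := le_antisymm (h0k ▸ ht.2) ht.1
    rw [htt]
  · obtain ⟨hcl, hf0, hE⟩ := run_from_τ_zero hSil s h0k
    exact cap_le_cap_of_sobolevDatum hC (stage_hasBoundedSobolevNormsOn s) s.τ_zero_mem_Icc hsl
      h0k S.f s.u s.p hcl hf0 hE rfl t ht

/-- **(ii) The host's cap binds the whole registered future**: on a silent design with single-signed swirl-free
`τ₀`-slice of height `M` and a cap constant `C`, a stage at a level `k ≥ 1` has speed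
`≤ C √(√((∫η₀)(∫r²η₀)) M)` on `[τ₀, τ_k] × ℝ³` (`η₀ = ω_θ/r` of the `τ₀`-slice).
[cite: GallaySverak2016, Prop. 2.6 (2.14)] [cite: Tao2011, Cor. 11.1] -/
theorem speed_le_cap_τ_zero_of_silent {C : ℝ} (hC : IsNoSwirlCapConstant C)
    (hSil : ∀ t, S.τ 0 ≤ t → S.f t = 0) (hk : 1 ≤ k) (s : Stage 1 R S m k) {M : ℝ}
    (hsl : SignedNoSwirlSlice (s.u (S.τ 0)) M) :
    ∀ t ∈ Icc (S.τ 0) (S.τ k), ∀ x,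
      ‖s.u t x‖ ≤ C * Real.sqrt (Real.sqrt ((∫ y, angVortQuot (s.u (S.τ 0)) y) *
        ∫ y, cylRadius y ^ 2 * angVortQuot (s.u (S.τ 0)) y) * M) := by
  have h0k : S.τ 0 < S.τ k := S.τ_strictMono (Nat.lt_of_lt_of_le Nat.zero_lt_one hk)
  obtain ⟨hcl, hf0, hE⟩ := run_from_τ_zero hSil s h0k
  exact speed_le_noSwirlCap_of_sobolevDatum hC (stage_hasBoundedSobolevNormsOn s) s.τ_zero_mem_Icc hsl
    h0k S.f s.u s.p hcl hf0 hE rfl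

/-- **(ii′) Every registered floor is under the host's cap value**: `c₁ Y_j ≤ C √(√((∫η₀)(∫r²η₀)) M)` for all
`j ≤ k` (`k ≥ 1`, silent design, single-signed swirl-free `τ₀`-slice). [cite: GallaySverak2016, Prop. 2.6 (2.14)]
[cite: Palasek2026ElementaryModel, §4] -/
theorem floor_le_cap_τ_zero_of_silent {C : ℝ} (hC : IsNoSwirlCapConstant C)
    (hSil : ∀ t, S.τ 0 ≤ t → S.f t = 0) (hk : 1 ≤ k) (s : Stage 1 R S m k) {M : ℝ}
    (hsl : SignedNoSwirlSlice (s.u (S.τ 0)) M) {j : ℕ} (hj : j ≤ k) :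
    S.c₁ * R.Y j ≤ C * Real.sqrt (Real.sqrt ((∫ y, angVortQuot (s.u (S.τ 0)) y) *
      ∫ y, cylRadius y ^ 2 * angVortQuot (s.u (S.τ 0)) y) * M) := by
  obtain ⟨x, -, hfl⟩ := s.floor j hj
  exact hfl.trans (speed_le_cap_τ_zero_of_silent hC hSil hk s hsl (S.τ j)
    ⟨S.τ_mono (Nat.zero_le j), S.τ_mono hj⟩ x)

/-- **(ii″) NON-REGISTRATION below the floor**: no silent design whose `τ₀`-slice is single-signed swirl-free
with cap value `< c₁ Y_k` registers a stage at level `k ≥ 1` (any rates and margins).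
[cite: GallaySverak2016, Prop. 2.6 (2.14)] [cite: Palasek2026ElementaryModel, §4] -/
theorem cap_τ_zero_not_lt_floor_of_silent {C : ℝ} (hC : IsNoSwirlCapConstant C)
    (hSil : ∀ t, S.τ 0 ≤ t → S.f t = 0) (hk : 1 ≤ k) (s : Stage 1 R S m k) {M : ℝ}
    (hsl : SignedNoSwirlSlice (s.u (S.τ 0)) M) :
    ¬ C * Real.sqrt (Real.sqrt ((∫ y, angVortQuot (s.u (S.τ 0)) y) *
        ∫ y, cylRadius y ^ 2 * angVortQuot (s.u (S.τ 0)) y) * M) < S.c₁ * R.Y k :=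
  not_lt.2 (floor_le_cap_τ_zero_of_silent hC hSil hk s hsl le_rfl)

/-- **(iii, wide rates) The host readout is at most HALF cap-efficient**: on the wide-base rates
(`2 Y₀ ≤ Y₁`, `TowerRates.wide_sep`) `2 ‖u(τ₀, x)‖ ≤ C √(√((∫η₀)(∫r²η₀)) M)` for every `x` (globally anchored
stage at a level `k ≥ 1`, silent design, single-signed swirl-free `τ₀`-slice). With `C = 0.35356` and the sharper
ratio `Y₀/Y₁ = 0.4863` of the wide rates: host efficiency `sup|u(τ₀)|/cap₀ ≤ 0.1720`.
[cite: GallaySverak2016, Prop. 2.6 (2.14)] [cite: Palasek2026ElementaryModel, §4] -/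
theorem two_mul_norm_τ_zero_le_cap_of_silent {C : ℝ} (hC : IsNoSwirlCapConstant C)
    {S : Schedule TowerRates.wide} (hSil : ∀ t, S.τ 0 ≤ t → S.f t = 0) (hk : 1 ≤ k)
    (s : Stage 1 TowerRates.wide S (Margins.routeG TowerRates.wide) k) {M : ℝ}
    (hsl : SignedNoSwirlSlice (s.u (S.τ 0)) M) (x : EuclideanSpace ℝ (Fin 3)) :
    2 * ‖s.u (S.τ 0) x‖ ≤ C * Real.sqrt (Real.sqrt ((∫ y, angVortQuot (s.u (S.τ 0)) y) *
      ∫ y, cylRadius y ^ 2 * angVortQuot (s.u (S.τ 0)) y) * M) := by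
  have h0 := s.norm_τ_zero_le x
  have h1 := floor_le_cap_τ_zero_of_silent hC hSil hk s hsl hk
  have hsep := TowerRates.wide_sep 0
  have hc₁ := S.c₁_pos
  nlinarith

/-- **(i″) NESTING in the census stratum**: on a silent wide design, a registered level-`k` stage whose
`τ₀`-slice is single-signed swirl-free of height `M` with `0.35356 √(√((∫η₀)(∫r²η₀)) M) < c₁ Y_{k+1}` is IN
the capped signed swirl-free stratum `InCapStratum k S s` of `CapStratum.lean` (its `τ_k`-slice is in the class
with the smaller cap value). [cite: GallaySverak2016, Prop. 2.6, Lemma 5.1, Lemma 6.4] [cite: Palasek2026ElementaryModel, §4] -/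
theorem inCapStratum_of_silent {S : Schedule TowerRates.wide} (hSil : ∀ t, S.τ 0 ≤ t → S.f t = 0)
    (s : Stage 1 TowerRates.wide S (Margins.routeG TowerRates.wide) k) {M : ℝ}
    (hsl : SignedNoSwirlSlice (s.u (S.τ 0)) M)
    (hlt : 0.35356 * Real.sqrt (Real.sqrt ((∫ y, angVortQuot (s.u (S.τ 0)) y) *
        ∫ y, cylRadius y ^ 2 * angVortQuot (s.u (S.τ 0)) y) * M) <
      S.c₁ * TowerRates.wide.Y (k + 1)) :
    InCapStratum k S s :=
  have hτk : S.τ k ∈ Icc (S.τ 0) (S.τ k) := ⟨S.τ_mono (Nat.zero_le k), le_rfl⟩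
  ⟨M, signedNoSwirlSlice_of_silent hSil s hsl _ hτk,
    (cap_le_cap_τ_zero_of_silent (by norm_num) hSil s hsl _ hτk).trans_lt hlt⟩

/-- **(iv) THE LEVEL-ZERO LEVER, at every level `k ≥ 0`**: ONE registered level-`k` stage of a pinned rigid
SILENT wide design whose `τ₀`-slice is single-signed swirl-free of height `M` with `C √(√((∫η₀)(∫r²η₀)) M) <
c₁ Y_{k+1}` refutes `HeredityAt k` (the extension agrees with the stage at `τ₀ ∈ [0, τ_k]` and is an unforced
finite-energy classical run on `[τ₀, τ_{k+1}]`, capped below its own floor). [cite: GallaySverak2016, Prop. 2.6 (2.14)]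
[cite: Palasek2026ElementaryModel, §4] -/
theorem not_heredityAt_of_silent_capped_τ_zero {C : ℝ} (hC : IsNoSwirlCapConstant C)
    {S : Schedule TowerRates.wide} (hSil : ∀ t, S.τ 0 ≤ t → S.f t = 0) (hP : S.Pins 8 (6 / 5))
    (hR : S.Rigid) (s : Stage 1 TowerRates.wide S (Margins.routeG TowerRates.wide) k) {M : ℝ}
    (hsl : SignedNoSwirlSlice (s.u (S.τ 0)) M)
    (hlt : C * Real.sqrt (Real.sqrt ((∫ y, angVortQuot (s.u (S.τ 0)) y) *
        ∫ y, cylRadius y ^ 2 * angVortQuot (s.u (S.τ 0)) y) * M) <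
      S.c₁ * TowerRates.wide.Y (k + 1)) :
    ¬ HeredityAt k := by
  intro h
  obtain ⟨s', hs'⟩ := h S hP hR (quiet_of_silent hSil) s
  have h0 : s'.u (S.τ 0) = s.u (S.τ 0) := (hs' (S.τ 0) s.τ_zero_mem_Icc).1
  have hsl' : SignedNoSwirlSlice (s'.u (S.τ 0)) M := by
    rw [h0]
    exact hsl
  obtain ⟨x, -, hfl⟩ := s'.floor (k + 1) le_rfl
  have hle := speed_le_cap_τ_zero_of_silent hC hSil (Nat.succ_le_succ (Nat.zero_le k)) s' hsl'
    (S.τ (k + 1)) ⟨S.τ_mono (Nat.zero_le _), le_rfl⟩ x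
  rw [h0] at hle
  linarith

/-- **(iv) at `k = 1`, on the route decl, with the number**: ONE registered level-1 stage of a pinned rigid silent
wide design whose `τ₀`-slice is single-signed swirl-free of height `M` with
`0.35356 √(√((∫η₀)(∫r²η₀)) M) < c₁ Y₂` (window `Y₁ = 2778 ≤ 0.35356 cap₀ < Y₂ = 6140` by (ii′)) refutes item
19249 `HeredityAtOne` (plain negative lemma; witness class nested in `InCapStratum 1`, uninhabited in the tree).
[cite: GallaySverak2016, Prop. 2.6 (2.14)] [cite: Palasek2026ElementaryModel, §4] -/
theorem heredityAtOne_false_of_silent_capped_τ_zero {S : Schedule TowerRates.wide}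
    (hSil : ∀ t, S.τ 0 ≤ t → S.f t = 0) (hP : S.Pins 8 (6 / 5)) (hR : S.Rigid)
    (s : Stage 1 TowerRates.wide S (Margins.routeG TowerRates.wide) 1) {M : ℝ}
    (hsl : SignedNoSwirlSlice (s.u (S.τ 0)) M)
    (hlt : 0.35356 * Real.sqrt (Real.sqrt ((∫ y, angVortQuot (s.u (S.τ 0)) y) *
        ∫ y, cylRadius y ^ 2 * angVortQuot (s.u (S.τ 0)) y) * M) <
      S.c₁ * TowerRates.wide.Y 2) :
    ¬ Theses.PalasekTowerBreakdown.HeredityAtOne := fun h =>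
  not_heredityAt_of_silent_capped_τ_zero isNoSwirlCapConstant_eighth hSil hP hR s hsl hlt
    (heredityAtOne_iff.1 h)

/-- **(iv) at `k = 0`**: ONE registered HOST (level-0 stage) of a pinned rigid silent wide design whose
`τ₀`-slice is single-signed swirl-free with `0.35356 √(√((∫η₀)(∫r²η₀)) M) < c₁ Y₁ = 2778` refutes
`HeredityAt 0` — the only rung whose lever needs no registered GROWN level. [cite: GallaySverak2016, Prop. 2.6 (2.14)]
[cite: Palasek2026ElementaryModel, §4] -/
theorem not_heredityAt_zero_of_silent_capped_host {S : Schedule TowerRates.wide}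
    (hSil : ∀ t, S.τ 0 ≤ t → S.f t = 0) (hP : S.Pins 8 (6 / 5)) (hR : S.Rigid)
    (s : Stage 1 TowerRates.wide S (Margins.routeG TowerRates.wide) 0) {M : ℝ}
    (hsl : SignedNoSwirlSlice (s.u (S.τ 0)) M)
    (hlt : 0.35356 * Real.sqrt (Real.sqrt ((∫ y, angVortQuot (s.u (S.τ 0)) y) *
        ∫ y, cylRadius y ^ 2 * angVortQuot (s.u (S.τ 0)) y) * M) <
      S.c₁ * TowerRates.wide.Y 1) :
    ¬ HeredityAt 0 :=
  not_heredityAt_of_silent_capped_τ_zero isNoSwirlCapConstant_eighth hSil hP hR s hsl hlt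

/-- **The emptiness conjunct of item 19249 on the silent sub-register is decided at the host**: `HeredityAtOne`
implies that NO pinned rigid silent wide design with a single-signed swirl-free `τ₀`-slice of
`0.35356`-cap value `< c₁ Y₂` registers level `1` (contrapositive of (iv); equivalently
`capStratumEmptyAt_one_of_heredityAtOne` read through `inCapStratum_of_silent`). [cite: Palasek2026ElementaryModel, §4] -/
theorem no_silent_capped_host_stage_of_heredityAtOne (h : Theses.PalasekTowerBreakdown.HeredityAtOne)
    {S : Schedule TowerRates.wide} (hSil : ∀ t, S.τ 0 ≤ t → S.f t = 0) (hP : S.Pins 8 (6 / 5))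
    (hR : S.Rigid) (s : Stage 1 TowerRates.wide S (Margins.routeG TowerRates.wide) 1) {M : ℝ}
    (hsl : SignedNoSwirlSlice (s.u (S.τ 0)) M) :
    S.c₁ * TowerRates.wide.Y 2 ≤ 0.35356 * Real.sqrt (Real.sqrt ((∫ y, angVortQuot (s.u (S.τ 0)) y) *
        ∫ y, cylRadius y ^ 2 * angVortQuot (s.u (S.τ 0)) y) * M) :=
  not_lt.1 fun hlt => heredityAtOne_false_of_silent_capped_τ_zero hSil hP hR s hsl hlt h

end Silent

end Summit.NavierStokesRegularity.HeredityAtOneSilentWindow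

end
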